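import Summits.Langlands.Langlands.Theses.BaseFieldAscent
import Summits.Langlands.Langlands.Theorems.BaseFieldAscentAscentConjugationSolvableStubPrimeTowerInduction
import Summits.Langlands.Langlands.Theorems.SmithKummerSeedCyclicPrimeDescentWeakGalToAutOfFacts
import Summits.Langlands.Langlands.Theorems.IrreducibilityBySelfDualityIrreducibleOffSectorBaseChange
import Summits.Langlands.Langlands.Theorems.IrreducibilityBySelfDualityIrreducibleOffSectorInductionAscent
import Literature.NumberTheory.Automorphic.AutomorphicInductionOfSelfTwist
import Literature.NumberTheory.Automorphic.BaseChangeCyclicCuspidal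
import Literature.NumberTheory.PAdicHodge.FontainePstInductionSchemata
import Literature.NumberTheory.PAdicHodge.DeRhamBaseChangeProofs
import Literature.NumberTheory.GaloisRepresentations.MackeyInducedIrreducible
import Literature.NumberTheory.GaloisRepresentations.InducedAEUnramified
import Literature.NumberTheory.GaloisRepresentations.FramedRepEquivConj
import Literature.NumberTheory.GaloisRepresentations.LAdicRepFrobenius
import Literature.NumberTheory.GaloisRepresentations.RestrictFieldSemisimple
import Literature.NumberTheory.GaloisRepresentations.CyclicExtensionOfInvariantRep

/-!
# Skeleton of the crux `AscentConjugationSolvable` (stmt-Langlands-1094) — line `registered`, RESHAPED by the lead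

(Kept unchanged by lead continuations c1 and c2, 2026-08-17: the two open stubs are VERBATIM the items
stmt-Langlands-18649 / stmt-Langlands-18645, whose own birth skeletons — `Lines/CyclicPrimeAscent_birth.lean`,
`Lines/CyclicPrimeDescent_birth.lean` — cut each along the direction seam into `stub_ascentAutToGal ∧
stub_ascentWeakGalToAut`, resp. `stub_descentAutToGal ∧ stub_descentWeakGalToAut`.)

STATE AFTER LEAD c2 (2026-08-17T15:30Z), all kernel-checked and landed `--supports stmt-Langlands-1094`:
* glue: crux ⇐ the four child stubs (`SmithKummerSeedCyclicPrimeGlue.ascentConjugationSolvable_of_fourStubs`, p168470;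
  descent piece p161600), closable shadow `recip_of_cyclicallyTowered` (UP-step alone ⇒ every cyclically-towered field);
* `stub_descentWeakGalToAut` is PROVED modulo six named facts (`descentWeakGalToAut_of_facts`, p168792: irreducible
  restriction — cyclic descent + prime twist matching, p165721/p164316; reducible restriction — prime-index Clifford
  p165356/p166527, geometric constituent p168058, non-stability p168118, automorphic induction + Henniart, p168679), hence
  crux ⇐ `stub_ascentAutToGal ∧ stub_ascentWeakGalToAut ∧ stub_descentAutToGal` + facts
  (`ascentConjugationSolvable_of_threeStubs_of_facts`, p168792);
* the open residue of `stub_descentAutToGal` is typed R-free as the ATOM `InertTwistCoherenceAE`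
  (`Cruxes/AscentConjugationSolvable/Atom.lean`: necessary) and certified sufficient for the weak (A)-descent in the
  cuspidal case (`descent_of_inertTwistCoherence`, p162893);
* what is NOT provable in tree: any term of `ReciprocityData` (stmt-Langlands-17930: `localLanglands_gl`,
  `nonempty_localEpsilonSystem_isCanonical`), transport of `LocalGlobalCompatibleAt` across a layer (stmt-18101 + a local
  base-change predicate), the atom (open since JPSS 1981 / Arthur–Clozel 1989), and — for `stub_ascentWeakGalToAut` — the
  de Rham DESCENT direction (converse of `DeRhamBaseChange`) and the cuspidal/induced shape of cyclic base change in the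
  `AutomorphicRepData` model.

Route `BaseFieldAscent` (crux rank 3; decl shared verbatim with `CMFern`, `SmithKummerSeed`):
reciprocity for `GL_n` over TR ∪ CM ⇒ reciprocity over every CONJUGATION-SOLVABLE number field `F`
(`F₀ ⊆ F ⊆ E`, `F₀` totally real, `E/F₀` finite Galois with solvable group).

Reshape (lead prover-line-stmt-Langlands-1094-0, 2026-08-17) of the birth skeleton `Lines/birth.lean`
(planner-skel-stmt-Langlands-1094-0): the SAME composition idea (UP along Galois layers from the totally real
floor `F₀` to `E`, DOWN along the layers of `E/F`), with the two transfer stubs re-cut from CYCLIC layers to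
layers of PRIME degree and the tower stub re-cut accordingly:

* `stub_primeTowerInduction` — pure Galois theory (size M, provable now): a property of number fields that
  climbs every Galois layer of PRIME degree climbs every finite Galois extension with SOLVABLE group and degree
  `> 1` (a non-trivial finite solvable group has a normal subgroup of prime index —
  `IrreducibleOffSector.exists_normal_prime_index_of_isSolvable`; fixed field; strong induction on the degree
  over all base fields; pattern of `Cruxes/AscentConjugationSolvable/Split.lean`, `recip_ascent_of_isSolvable`).
  The degree-one layer is EXCLUDED (`1 < [E:K]`): for an arbitrary `P` it would be transport along a field
  isomorphism, which the composition below never needs.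
* `stub_primeAscent` — VERBATIM the body of item stmt-Langlands-18649 `SmithKummerSeed.CyclicPrimeAscent`
  (UP one Galois layer of prime degree; Arthur–Clozel automorphic induction / base change, Clifford theory,
  de-induction over twists; size L–XL).
* `stub_primeDescent` — VERBATIM the body of item stmt-Langlands-18645 `SmithKummerSeed.CyclicPrimeDescent`
  (DOWN one Galois layer of prime degree; the crux's recorded open residue: non-normal solvable descent, the
  twist ambiguity at INERT places; Arthur–Clozel Ch. 3 §7 closing remark, Rajan 2002, Lapid–Rogawski 1998).

Why the reshape: the registered cyclic stubs contained the degree-one layer (a Galois extension with trivial,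
hence cyclic, group), i.e. transport of `ReciprocityData` and of `GlobalLanglandsCorrespondenceGLn` along an
isomorphism of number fields — mathematically empty, Lean-XL (places, completions, local Langlands data,
automorphic and Galois sides are all indexed by the field TYPE). Prime-degree layers never degenerate, and the
two degenerate situations of the assembly (`[E:F] = 1`, `[F:F₀] = 1`) are settled by transporting only
`IsGalois` / `IsSolvable` / `IsTotallyReal` along `F ≃ₐ[F₀] E`, resp. `F₀ ≃+* F` (Mathlib lemmas), exactly as
in the strategist's proved split. The prime stubs are weaker than the cyclic ones and coincide with two
EXISTING crux items, so their closure closes this crux through the composition below.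

Composition `AscentConjugationSolvable_of` (real proof, no `sorry`): reciprocity over `F₀` (TR hypothesis);
`E/F` Galois with solvable group (`Gal(E/F) ↪ Gal(E/F₀)` by restriction of scalars); if `[E:F] = 1` then `F/F₀`
is Galois solvable and either `F` is totally real (`[F:F₀] = 1`) or reciprocity climbs `F₀ ↝ F` by the tower
stub fed with `stub_primeAscent`; else it climbs `F₀ ↝ E` and then DESCENDS `E ↝ F` by the tower stub applied
to the ascending predicate `X ↦ (Recip X → Recip F)`, whose prime step is `stub_primeDescent` composed on the
left. Sorries: two (`stub_primeAscent`, `stub_primeDescent`); `stub_primeTowerInduction` is closed by import (p150349).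
-/

set_option linter.dupNamespace false
set_option linter.unusedVariables false

noncomputable section

namespace Summit.Langlands.Langlands.Cruxes.AscentConjugationSolvable.Birth

open Summit.Langlands

/-! ## Registered stubs (reshaped) -/

/-- STUB 1 — prime-step tower induction (pure Galois theory, size M) — CLOSED: landed as
`Summit.Langlands.Langlands.Theorems.BaseFieldAscentAscentConjugationSolvable.stub_primeTowerInduction`
(Theorems/BaseFieldAscentAscentConjugationSolvableStubPrimeTowerInduction.lean, p150349, 2026-08-17): a property
of number fields that passes UP every Galois layer of PRIME degree passes up every finite Galois extension with
SOLVABLE Galois group and degree `> 1` (strong induction on `[E:K]` over all base fields through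
`AscentConjugationSolvableSplit.galois_prime_step`). [folklore] -/
theorem stub_primeTowerInduction :
    ∀ (P : (K : Type) → [Field K] → [NumberField K] → Prop),
      (∀ (K L : Type) [Field K] [NumberField K] [Field L] [NumberField L] [Algebra K L]
          [IsGalois K L], (Module.finrank K L).Prime → P K → P L) →
      ∀ (K E : Type) [Field K] [NumberField K] [Field E] [NumberField E] [Algebra K E]
        [IsGalois K E], IsSolvable (E ≃ₐ[K] E) → 1 < Module.finrank K E → P K → P E :=
  Summit.Langlands.Langlands.Theorems.BaseFieldAscentAscentConjugationSolvable.stub_primeTowerInduction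

/-- STUB 2 — reciprocity ASCENDS along a Galois layer of prime degree (verbatim the body of item
stmt-Langlands-18649 `SmithKummerSeed.CyclicPrimeAscent`; size L–XL): for `L/K` Galois of prime degree, full
reciprocity for `GL_n` over `K` (both directions, every finite place, all `n`) implies full reciprocity over
`L` — automorphic induction of the twists `π′ ⊗ χ` to `K`, (A) over `K`, Clifford theory and de-induction over
a separating family of twists for (A) over `L`; `Ind`, (B) over `K`, cyclic base change and (A) over `L` for
(B) over `L`. [cite: ArthurClozelAMS120, Ch. 3 Thms 4.2, 5.1, 6.2] [cite: Taylor1994, §3] -/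
theorem stub_primeAscent :
    ∀ (K L : Type) [Field K] [NumberField K] [Field L] [NumberField L] [Algebra K L] [IsGalois K L], (Module.finrank K L).Prime → (∃ R : ReciprocityData K, ∀ n : ℕ, 0 < n → ∀ hcpt : Literature.NumberTheory.Automorphic.isCompact_glFiniteIntegralLevel n K, GlobalLanglandsCorrespondenceGLn n K R hcpt) → ∃ R : ReciprocityData L, ∀ n : ℕ, 0 < n → ∀ hcpt : Literature.NumberTheory.Automorphic.isCompact_glFiniteIntegralLevel n L, GlobalLanglandsCorrespondenceGLn n L R hcpt := by
  sorry

/-- STUB 3 — reciprocity DESCENDS along a Galois layer of prime degree (verbatim the body of item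
stmt-Langlands-18645 `SmithKummerSeed.CyclicPrimeDescent`; the open core, size XL): for `L/K` Galois of prime
degree, full reciprocity for `GL_n` over `L` implies full reciprocity over `K` — direction (B) over `K` by
Arthur–Clozel cyclic descent matched through (A) over `K`; direction (A) over `K` = descent of `ρ_{BC(π)}` to
`Γ_K` with the twist `η^j` pinned at the INERT places (solvable non-normal base change; known for `n = 1` and
for the cubic lift on `GL_2`). [cite: ArthurClozelAMS120, Ch. 3 Thm 4.2 and §7]
[cite: doi:10.4310/mrl.2002.v9.n4.a9, Thms 1–2] -/
theorem stub_primeDescent :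
    ∀ (K L : Type) [Field K] [NumberField K] [Field L] [NumberField L] [Algebra K L] [IsGalois K L], (Module.finrank K L).Prime → (∃ R : ReciprocityData L, ∀ n : ℕ, 0 < n → ∀ hcpt : Literature.NumberTheory.Automorphic.isCompact_glFiniteIntegralLevel n L, GlobalLanglandsCorrespondenceGLn n L R hcpt) → ∃ R : ReciprocityData K, ∀ n : ℕ, 0 < n → ∀ hcpt : Literature.NumberTheory.Automorphic.isCompact_glFiniteIntegralLevel n K, GlobalLanglandsCorrespondenceGLn n K R hcpt := by
  sorry

/-! ## The composition (sorry-free) -/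

/-- COMPOSITION: the three stub statements imply the crux `BaseFieldAscent.AscentConjugationSolvable` (route
decl, by name). From the witness `F₀ ⊆ F ⊆ E`: reciprocity over the totally real floor `F₀`; `E/F` is Galois
with solvable group (restriction of scalars embeds `Gal(E/F)` into `Gal(E/F₀)`); degenerate top layer
`[E:F] = 1`: `F ≃ₐ[F₀] E`, so `F/F₀` is Galois with solvable group, and either `[F:F₀] = 1` (`F` is totally
real — the hypothesis applies) or reciprocity climbs `F₀ ↝ F` (tower stub with the prime ascent step);
otherwise `1 < [E:F] ≤ [E:F₀]`: reciprocity climbs `F₀ ↝ E` and descends `E ↝ F` (tower stub applied to the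
ascending predicate `X ↦ (Recip X → Recip F)`, whose prime step is the prime descent composed on the left).
No transport of reciprocity along field isomorphisms; the CM half of the hypothesis is unused. [folklore] -/
theorem AscentConjugationSolvable_of
    (hTower : ∀ (P : (K : Type) → [Field K] → [NumberField K] → Prop),
      (∀ (K L : Type) [Field K] [NumberField K] [Field L] [NumberField L] [Algebra K L]
          [IsGalois K L], (Module.finrank K L).Prime → P K → P L) →
      ∀ (K E : Type) [Field K] [NumberField K] [Field E] [NumberField E] [Algebra K E]
        [IsGalois K E], IsSolvable (E ≃ₐ[K] E) → 1 < Module.finrank K E → P K → P E)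
    (hUp : ∀ (K L : Type) [Field K] [NumberField K] [Field L] [NumberField L] [Algebra K L]
      [IsGalois K L], (Module.finrank K L).Prime →
      (∃ R : ReciprocityData K, ∀ n : ℕ, 0 < n →
          ∀ hcpt : Literature.NumberTheory.Automorphic.isCompact_glFiniteIntegralLevel n K,
            GlobalLanglandsCorrespondenceGLn n K R hcpt) →
      ∃ R : ReciprocityData L, ∀ n : ℕ, 0 < n →
          ∀ hcpt : Literature.NumberTheory.Automorphic.isCompact_glFiniteIntegralLevel n L,
            GlobalLanglandsCorrespondenceGLn n L R hcpt)
    (hDown : ∀ (K L : Type) [Field K] [NumberField K] [Field L] [NumberField L] [Algebra K L]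
      [IsGalois K L], (Module.finrank K L).Prime →
      (∃ R : ReciprocityData L, ∀ n : ℕ, 0 < n →
          ∀ hcpt : Literature.NumberTheory.Automorphic.isCompact_glFiniteIntegralLevel n L,
            GlobalLanglandsCorrespondenceGLn n L R hcpt) →
      ∃ R : ReciprocityData K, ∀ n : ℕ, 0 < n →
          ∀ hcpt : Literature.NumberTheory.Automorphic.isCompact_glFiniteIntegralLevel n K,
            GlobalLanglandsCorrespondenceGLn n K R hcpt) :
    Summit.Langlands.Langlands.Theses.BaseFieldAscent.AscentConjugationSolvable := by
  intro hTRCM F _ _ hF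
  obtain ⟨F₀, E, iF₀, iNF₀, iE, iNE, iA₀, iA, iA₀E, iST, iGal, hTR, hsolv⟩ := hF
  letI := iF₀; letI := iNF₀; letI := iE; letI := iNE; letI := iA₀; letI := iA; letI := iA₀E
  haveI := iST; haveI := iGal
  -- (1) reciprocity over the totally real floor `F₀` (the TR ∪ CM hypothesis of the crux)
  have hRF₀ : ∃ R : ReciprocityData F₀, ∀ n : ℕ, 0 < n →
      ∀ hcpt : Literature.NumberTheory.Automorphic.isCompact_glFiniteIntegralLevel n F₀,
        GlobalLanglandsCorrespondenceGLn n F₀ R hcpt :=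
    hTRCM F₀ (Or.inl hTR)
  haveI : FiniteDimensional F₀ E := Module.Finite.of_restrictScalars_finite ℚ F₀ E
  haveI : FiniteDimensional F₀ F := Module.Finite.of_restrictScalars_finite ℚ F₀ F
  haveI : FiniteDimensional F E := Module.Finite.of_restrictScalars_finite ℚ F E
  -- (2) `E/F` is Galois, and `Gal(E/F)` embeds in the solvable `Gal(E/F₀)`
  haveI : IsGalois F E := IsGalois.tower_top_of_isGalois F₀ F E
  have hsolvF : IsSolvable (E ≃ₐ[F] E) := by
    let φ : (E ≃ₐ[F] E) →* (E ≃ₐ[F₀] E) :=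
      { toFun := fun σ => σ.restrictScalars F₀
        map_one' := AlgEquiv.ext fun _ => rfl
        map_mul' := fun _ _ => AlgEquiv.ext fun _ => rfl }
    haveI : IsSolvable (E ≃ₐ[F₀] E) := hsolv
    exact solvable_of_solvable_injective (f := φ) (AlgEquiv.restrictScalars_injective F₀)
  by_cases hFE : Module.finrank F E = 1
  · -- (3a) degenerate top layer: `F ≃ E` over `F₀`, so `F/F₀` is itself Galois with solvable group
    have hbij : Function.Bijective (algebraMap F E) :=
      (Algebra.finrank_eq_one_iff_bijective_algebraMap).mp hFE
    let e : F ≃ₐ[F₀] E := AlgEquiv.ofBijective (IsScalarTower.toAlgHom F₀ F E) hbij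
    haveI : IsGalois F₀ F := IsGalois.of_algEquiv e.symm
    have hsolvF₀F : IsSolvable (F ≃ₐ[F₀] F) := by
      haveI : IsSolvable (E ≃ₐ[F₀] E) := hsolv
      exact solvable_of_surjective (f := e.symm.autCongr.toMonoidHom) e.symm.autCongr.surjective
    by_cases hF₀F : Module.finrank F₀ F = 1
    · -- doubly degenerate: `F ≃ F₀` is totally real, the hypothesis applies to `F` itself
      have hbij₀ : Function.Bijective (algebraMap F₀ F) :=
        (Algebra.finrank_eq_one_iff_bijective_algebraMap).mp hF₀F
      haveI : NumberField.IsTotallyReal F₀ := hTR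
      haveI : NumberField.IsTotallyReal F :=
        NumberField.IsTotallyReal.ofRingEquiv (RingEquiv.ofBijective (algebraMap F₀ F) hbij₀)
      exact hTRCM F (Or.inl inferInstance)
    · -- UP from `F₀` to `F` along the solvable Galois extension `F/F₀` of degree `> 1`
      exact hTower (fun (K : Type) [Field K] [NumberField K] =>
          ∃ R : ReciprocityData K, ∀ n : ℕ, 0 < n →
            ∀ hcpt : Literature.NumberTheory.Automorphic.isCompact_glFiniteIntegralLevel n K,
              GlobalLanglandsCorrespondenceGLn n K R hcpt)
        hUp F₀ F hsolvF₀F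
        (lt_of_le_of_ne (Nat.succ_le_of_lt Module.finrank_pos) (Ne.symm hF₀F)) hRF₀
  · -- (3b) generic case: `1 < [E:F] ≤ [E:F₀]`
    have hltFE : 1 < Module.finrank F E :=
      lt_of_le_of_ne (Nat.succ_le_of_lt Module.finrank_pos) (Ne.symm hFE)
    have hltE : 1 < Module.finrank F₀ E :=
      calc 1 < Module.finrank F E := hltFE
        _ ≤ Module.finrank F₀ F * Module.finrank F E := Nat.le_mul_of_pos_left _ Module.finrank_pos
        _ = Module.finrank F₀ E := Module.finrank_mul_finrank F₀ F E
    -- UP: climb the solvable Galois extension `E/F₀` prime layer by prime layer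
    have hRE : ∃ R : ReciprocityData E, ∀ n : ℕ, 0 < n →
        ∀ hcpt : Literature.NumberTheory.Automorphic.isCompact_glFiniteIntegralLevel n E,
          GlobalLanglandsCorrespondenceGLn n E R hcpt :=
      hTower (fun (K : Type) [Field K] [NumberField K] =>
          ∃ R : ReciprocityData K, ∀ n : ℕ, 0 < n →
            ∀ hcpt : Literature.NumberTheory.Automorphic.isCompact_glFiniteIntegralLevel n K,
              GlobalLanglandsCorrespondenceGLn n K R hcpt)
        hUp F₀ E hsolv hltE hRF₀
    -- DOWN: the ascending predicate `X ↦ (Recip X → Recip F)` holds at `F` trivially and climbs each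
    -- prime layer by prime descent composed on the left; evaluate it at `E`.
    have hDesc :
        (∃ R : ReciprocityData E, ∀ n : ℕ, 0 < n →
          ∀ hcpt : Literature.NumberTheory.Automorphic.isCompact_glFiniteIntegralLevel n E,
            GlobalLanglandsCorrespondenceGLn n E R hcpt) →
        ∃ R : ReciprocityData F, ∀ n : ℕ, 0 < n →
          ∀ hcpt : Literature.NumberTheory.Automorphic.isCompact_glFiniteIntegralLevel n F,
            GlobalLanglandsCorrespondenceGLn n F R hcpt :=
      hTower (fun (K : Type) [Field K] [NumberField K] =>
          (∃ R : ReciprocityData K, ∀ n : ℕ, 0 < n →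
            ∀ hcpt : Literature.NumberTheory.Automorphic.isCompact_glFiniteIntegralLevel n K,
              GlobalLanglandsCorrespondenceGLn n K R hcpt) →
          ∃ R : ReciprocityData F, ∀ n : ℕ, 0 < n →
            ∀ hcpt : Literature.NumberTheory.Automorphic.isCompact_glFiniteIntegralLevel n F,
              GlobalLanglandsCorrespondenceGLn n F R hcpt)
        (fun K L _ _ _ _ _ _ hp hK hL => hK (hDown K L hp hL)) F E hsolvF hltFE id
    exact hDesc hRE

/-- The same composition with the three registered stubs consumed BY NAME (kernel check that the hypotheses of
`AscentConjugationSolvable_of` are the stub signatures verbatim; inherits their `sorry`s, contains none).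
[folklore] -/
theorem AscentConjugationSolvable_of_stubs :
    Summit.Langlands.Langlands.Theses.BaseFieldAscent.AscentConjugationSolvable :=
  AscentConjugationSolvable_of stub_primeTowerInduction stub_primeAscent stub_primeDescent

/-! ## Lead c3 (2026-08-17): the UP-step's (B)-half `stub_ascentWeakGalToAut` (18649 stub 2) modulo named facts

Helper stubs (registered; workers land them `--supports stmt-Langlands-1094`), then the sorry-free compositions
`ascentWeakGalToAut_of_extends` (case: `ρ` extends to `Γ_K`), `ascentWeakGalToAut_of_regular` (case: `ρ`
Galois-regular), `ascentWeakGalToAut_of_facts` (= the registered signature of `stub_ascentWeakGalToAut` modulo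
facts) and `ascentConjugationSolvable_of_twoStubs_of_facts` (crux ⇐ the two (A)-halves + facts). -/

section LeadC3

open scoped MatrixGroups NumberField Classical Matrix Polynomial
open Filter IsDedekindDomain Field
open Literature.NumberTheory.Automorphic Literature.NumberTheory.GaloisRepresentations Literature.NumberTheory.PAdicHodge

/-- HELPER STUB H1 — **extend-or-regular dichotomy along a Galois layer of PRIME degree** (Clifford 1937 /
Isaacs (11.22); tree: `FramedGaloisRep.exists_restrictField_eq_of_forall_outerConj`, abstract
`FramedRep.exists_comp_eq_of_forall_mem_range_iff` with `τ₀` any element outside `res(Γ_L)`, which generates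
the quotient of prime order): an irreducible `ρ : Γ_L → GL_n(ℚ̄_ℓ)` either is the restriction of a framed
representation of `Γ_K`, or none of its conjugates `ρ^g`, `g ∉ res(Γ_L)`, is isomorphic to it.
[cite: Isaacs1976, (11.22)] [cite: Clifford1937, Thm. 1] -/
theorem extendsOrRegular_of_prime : ∀ (K L : Type) [Field K] [NumberField K] [Field L] [NumberField L] [Algebra K L] [IsGalois K L], (Module.finrank K L).Prime → ∀ (ℓ : ℕ) [Fact ℓ.Prime] (n : ℕ) (ρ : Literature.NumberTheory.GaloisRepresentations.FramedGaloisRep L (PadicAlgCl ℓ) n), ρ.toGaloisRep.IsIrreducible → (∃ ρ₀ : Literature.NumberTheory.GaloisRepresentations.FramedGaloisRep K (PadicAlgCl ℓ) n, ρ₀.restrictField L = ρ) ∨ (∀ g : Field.absoluteGaloisGroup K, g ∉ Set.range (Literature.NumberTheory.GaloisRepresentations.absGaloisRestrict K L) → ∀ P : GL (Fin n) (PadicAlgCl ℓ), Literature.NumberTheory.GaloisRepresentations.FramedRep.conj P (ρ.outerConj g) ≠ ρ) := by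
  sorry

/-- HELPER STUB H2 — **geometricity DESCENDS along the layer** (unramified a.e.: inertia at the places of `K`
unramified in `L` lies in `res(Γ_L)`, `eventually_forall_inertia_le_range_absGaloisRestrict`; de Rham at
`v ∣ ℓ`: the de Rham DESCENT schema for THE pinned Fontaine data, Brinon–Conrad Prop. 6.3.8 "if and only if",
supplied as the explicit first hypothesis — to be filed as the Literature fact `DeRhamRestrictFieldDescent`):
if `ρ₀|_{Γ_L}` is `R`-geometric over `L` then `ρ₀` is `R₀`-geometric over `K` (any data: the Hodge datum is pinned).
[cite: BrinonConrad2009, Prop. 6.3.8] [cite: SerreAbelianLadic1968, Ch. I §2.1] -/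
theorem isGeometricFramed_of_restrictField_of_deRhamDescent : (∀ (K L : Type) [Field K] [NumberField K] [Field L] [NumberField L] [Algebra K L] (ℓ : ℕ) [Fact ℓ.Prime] (n : ℕ) (ρ : Literature.NumberTheory.GaloisRepresentations.FramedGaloisRep K (PadicAlgCl ℓ) n), (∀ (w : IsDedekindDomain.HeightOneSpectrum (NumberField.RingOfIntegers L)) (hw : ((ℓ : ℕ) : NumberField.RingOfIntegers L) ∈ w.asIdeal), (Literature.NumberTheory.PAdicHodge.fontainePstAdicCompletion w ℓ hw).IsDeRhamFramed ((ρ.restrictField L).toLocal w)) → ∀ (v : IsDedekindDomain.HeightOneSpectrum (NumberField.RingOfIntegers K)) (hv : ((ℓ : ℕ) : NumberField.RingOfIntegers K) ∈ v.asIdeal), (Literature.NumberTheory.PAdicHodge.fontainePstAdicCompletion v ℓ hv).IsDeRhamFramed (ρ.toLocal v)) → ∀ (K L : Type) [Field K] [NumberField K] [Field L] [NumberField L] [Algebra K L] (R₀ : ReciprocityData K) (R : ReciprocityData L) (ℓ : ℕ) [Fact ℓ.Prime] (n : ℕ) (ρ₀ : Literature.NumberTheory.GaloisRepresentations.FramedGaloisRep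 K (PadicAlgCl ℓ) n), IsGeometricFramed R (ρ₀.restrictField L) → IsGeometricFramed R₀ ρ₀ := by
  sorry

/-- HELPER STUB H3 — **a non-self-twist INERT place** (the hypothesis of `baseChange_cyclic_cuspidal`): for
`L/K` Galois of prime degree `p`, `π` a.e. Satake–Frobenius compatible with `ρ₀` and `ρ₀|_{Γ_L}` IRREDUCIBLE,
some place `v` of `K` inert in `L` carries a Satake parameter of `π` not fixed by any primitive `p`-th root of
unity — else `ρ₀` and `ρ₀ ⊗ η` (`η` the order-`p` character of `Gal(L/K)`) have equal Frobenius polynomials a.e.,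
so `ρ₀ ≅ ρ₀ ⊗ η` (Chebotarev + Brauer–Nesbitt), so `ρ₀|_{Γ_L}` is reducible
(`not_isIrreducible_restrictField_of_conj_eq_twist`). [cite: ArthurClozelAMS120, Ch. 3, proof of Thm. 3.1 and Thm. 4.2 (a)] -/
theorem exists_inert_nonSelfTwist_of_irreducible_restrictField : ∀ (K L : Type) [Field K] [NumberField K] [Field L] [NumberField L] [Algebra K L] [IsGalois K L], (Module.finrank K L).Prime → ∀ (n : ℕ) (hK : Literature.NumberTheory.Automorphic.isCompact_glFiniteIntegralLevel n K) (ℓ : ℕ) [Fact ℓ.Prime] (ι : PadicAlgCl ℓ ≃+* ℂ) (π : Literature.NumberTheory.Automorphic.AutomorphicRepData (Literature.NumberTheory.Automorphic.AutomorphyDatum.gl n K hK)) (ρ₀ : Literature.NumberTheory.GaloisRepresentations.FramedGaloisRep K (PadicAlgCl ℓ) n), (ρ₀.restrictField L).toGaloisRep.IsIrreducible → (∀ᶠ v : IsDedekindDomain.HeightOneSpectrum (NumberField.RingOfIntegers K) in Filter.cofinite, SatakeFrobCompatibleAt ι π ρ₀ v) → ∃ (v : IsDedekindDomain.HeightOneSpectrum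 (NumberField.RingOfIntegers K)) (w : IsDedekindDomain.HeightOneSpectrum (NumberField.RingOfIntegers L)) (α : Multiset ℂ), w.asIdeal.under (NumberField.RingOfIntegers K) = v.asIdeal ∧ w.asIdeal.inertiaDeg (NumberField.RingOfIntegers K) = Module.finrank K L ∧ π.HasSatakeParamAt v α ∧ ∀ ζ : ℂ, IsPrimitiveRoot ζ (Module.finrank K L) → α.map (ζ * ·) ≠ α := by
  sorry

/-- HELPER STUB H4 — **Mackey: the induction of a Galois-REGULAR irreducible is irreducible** (tree:
`FramedGaloisRep.isIrreducible_induce_of_forall_ne_conj`, fed from regularity by `outerConj_mul` and the commutation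
of `conj` with `outerConj`). [cite: SerreLinearRepresentations1977, §7.4 Prop. 23 and Cor.] -/
theorem isIrreducible_induce_of_regular : ∀ (K L : Type) [Field K] [NumberField K] [Field L] [NumberField L] [Algebra K L] [IsGalois K L] (ℓ : ℕ) [Fact ℓ.Prime] (n : ℕ) (ρ : Literature.NumberTheory.GaloisRepresentations.FramedGaloisRep L (PadicAlgCl ℓ) n), ρ.toGaloisRep.IsIrreducible → (∀ g : Field.absoluteGaloisGroup K, g ∉ Set.range (Literature.NumberTheory.GaloisRepresentations.absGaloisRestrict K L) → ∀ P : GL (Fin n) (PadicAlgCl ℓ), Literature.NumberTheory.GaloisRepresentations.FramedRep.conj P (ρ.outerConj g) ≠ ρ) → (ρ.induce K (rfl : Module.finrank K L = Module.finrank K L)).toGaloisRep.IsIrreducible := by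
  sorry

/-- HELPER STUB H5 — **L-algebraicity descends through a cyclic automorphic induction** (Henniart 2012 Thm. 5:
the `a`-exponents of `P = AI(π)` at `σ` are the union of those of `π` at the `σ' ∣ σ`; uniqueness of archimedean
parameters `AutomorphicRepData.hasArchParameter_unique`; well-formedness swaps `a`/`b`), granted Henniart's fact and
Clozel's existence of infinity types. [cite: Henniart2012, Thm. 5 and Remarque §3.7] [cite: BuzzardGeeLMS2014, Def. 3.1.1] -/
theorem isLAlgebraic_of_isAutomorphicInductionAlong : Literature.NumberTheory.Automorphic.Henniart2012_infinityType_of_automorphicInduction → (∀ (n : ℕ) (K : Type) [Field K] [NumberField K] (hK : Literature.NumberTheory.Automorphic.isCompact_glFiniteIntegralLevel n K) (π : Literature.NumberTheory.Automorphic.AutomorphicRepData (Literature.NumberTheory.Automorphic.AutomorphyDatum.gl n K hK)), π.exists_hasInfinityType) → ∀ (K L : Type) [Field K] [NumberField K] [Field L] [NumberField L] [Algebra K L] [IsGalois K L], IsCyclic (L ≃ₐ[K] L) → ∀ (n d : ℕ), 0 < n → Module.finrank K L = d → ∀ (hK : Literature.NumberTheory.Automorphic.isCompact_glFiniteIntegralLevel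 (d * n) K) (hL : Literature.NumberTheory.Automorphic.isCompact_glFiniteIntegralLevel n L) (P : Literature.NumberTheory.Automorphic.CuspidalAutomorphicRepData (d * n) K hK) (π : Literature.NumberTheory.Automorphic.CuspidalAutomorphicRepData n L hL), Literature.NumberTheory.Automorphic.IsAutomorphicInductionAlong π.1 P.1 → P.1.IsLAlgebraic → π.1.IsLAlgebraic := by
  sorry

/-- HELPER STUB H6 — **the Satake data of an avatar of `Ind_L^K ρ` are `μ_p`-stable at the inert places** (the
hypothesis of `ArthurClozel1989_automorphicInduction_of_selfTwist`): at a place `v` inert in `L` (one `w ∣ v`,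
`f = p`) the Frobenius polynomial of `Ind ρ` is `P_w(X^p)` (`hasFrobCharpolyAt_induce`), whose root multiset is
stable under the `p`-th roots of unity; read back on `α` through `arithFrobPolyOfSatake ι q_v 1 α`.
[cite: ArthurClozelAMS120, Ch. 3, proof of Thm. 6.2 ((6.2), (6.6))] -/
theorem selfTwistStable_of_compatible_induce : ∀ (K L : Type) [Field K] [NumberField K] [Field L] [NumberField L] [Algebra K L] [IsGalois K L], (Module.finrank K L).Prime → ∀ (n : ℕ) (ℓ : ℕ) [Fact ℓ.Prime] (ι : PadicAlgCl ℓ ≃+* ℂ) (ρ : Literature.NumberTheory.GaloisRepresentations.FramedGaloisRep L (PadicAlgCl ℓ) n), (∀ᶠ w : IsDedekindDomain.HeightOneSpectrum (NumberField.RingOfIntegers L) in Filter.cofinite, ρ.IsUnramifiedAt w) → ∀ (hK : Literature.NumberTheory.Automorphic.isCompact_glFiniteIntegralLevel (Module.finrank K L * n) K) (P : Literature.NumberTheory.Automorphic.AutomorphicRepData (Literature.NumberTheory.Automorphic.AutomorphyDatum.gl (Module.finrank K L * n) K hK)), (∀ᶠ v : IsDedekindDomain.HeightOneSpectrum (NumberField.RingOfIntegers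 K) in Filter.cofinite, SatakeFrobCompatibleAt ι P (ρ.induce K (rfl : Module.finrank K L = Module.finrank K L)) v) → ∀ᶠ v : IsDedekindDomain.HeightOneSpectrum (NumberField.RingOfIntegers K) in Filter.cofinite, ∀ (w : IsDedekindDomain.HeightOneSpectrum (NumberField.RingOfIntegers L)) (α : Multiset ℂ), w.asIdeal.under (NumberField.RingOfIntegers K) = v.asIdeal → w.asIdeal.inertiaDeg (NumberField.RingOfIntegers K) = Module.finrank K L → P.HasSatakeParamAt v α → ∀ ζ : ℂ, IsPrimitiveRoot ζ (Module.finrank K L) → α.map (ζ * ·) = α := by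
  sorry

/-- HELPER STUB H7 — **block-diagonal framed representations with IRREDUCIBLE blocks: semisimplicity, and the
Jordan–Hölder pick** (abstract, any topological group `G`, coefficients `ℚ̄_ℓ`): if `S`, `S'` are framed
representations of rank `d·m` whose matrices are the block-diagonals `diag(a₀,…,a_{d-1})`, `diag(b₀,…,b_{d-1})`
(frame `finProdFinEquiv`, the shape of `induce_restrictField_apply_coe`) of irreducible framed representations,
then `S` is semisimple, and if moreover `S' = P S P⁻¹` then every block `b j` is conjugate to some block `a i`
(Schur: a non-zero intertwiner between irreducibles is invertible). [cite: SerreLinearRepresentations1977, §2.3 and §7.3]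
[cite: CurtisReiner1962, (27.3)] -/
theorem blockDiagonal_semisimple_and_pick : ∀ (G : Type) [Group G] [TopologicalSpace G] [IsTopologicalGroup G] (ℓ : ℕ) [Fact ℓ.Prime] (d m : ℕ) (a b : Fin d → Literature.NumberTheory.GaloisRepresentations.FramedRep G (PadicAlgCl ℓ) m) (S S' : Literature.NumberTheory.GaloisRepresentations.FramedRep G (PadicAlgCl ℓ) (d * m)), (∀ g : G, ((S g : GL (Fin (d * m)) (PadicAlgCl ℓ)) : Matrix (Fin (d * m)) (Fin (d * m)) (PadicAlgCl ℓ)) = Matrix.reindex finProdFinEquiv finProdFinEquiv (Matrix.comp (Fin d) (Fin d) (Fin m) (Fin m) (PadicAlgCl ℓ) (Matrix.diagonal fun i => ((a i g : GL (Fin m) (PadicAlgCl ℓ)) : Matrix (Fin m) (Fin m) (PadicAlgCl ℓ))))) → (∀ g : G, ((S' g : GL (Fin (d * m)) (PadicAlgCl ℓ)) : Matrix (Fin (d * m)) (Fin (d * m)) (PadicAlgCl ℓ)) = Matrix.reindex finProdFinEquiv finProdFinEquiv (Matrix.comp (Fin d) (Fin d) (Fin m) (Fin m) (PadicAlgCl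 ℓ) (Matrix.diagonal fun i => ((b i g : GL (Fin m) (PadicAlgCl ℓ)) : Matrix (Fin m) (Fin m) (PadicAlgCl ℓ))))) → (∀ i, (a i).IsIrreducible) → (∀ i, (b i).IsIrreducible) → S.toContinuousRep.IsSemisimple ∧ ∀ P : GL (Fin (d * m)) (PadicAlgCl ℓ), S' = Literature.NumberTheory.GaloisRepresentations.FramedRep.conj P S → ∀ j : Fin d, ∃ (i : Fin d) (Q : GL (Fin m) (PadicAlgCl ℓ)), b j = Literature.NumberTheory.GaloisRepresentations.FramedRep.conj Q (a i) := by
  sorry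

/-- HELPER STUB H8 (the lead's) — **the PICK in the Galois-regular case**: `ρ : Γ_L → GL_n(ℚ̄_ℓ)` irreducible,
Galois-regular, unramified a.e.; `P` on `GL_{pn}(𝔸_K)` a.e. compatible with `Ind_L^K ρ`; `Pf τ` (`τ ∈ Gal(L/K)`)
cuspidal on `GL_n(𝔸_L)`, Galois-conjugate to `Pf 1` on Satake parameters and each automorphically inducing to
`P`; `ρ₁` an irreducible a.e. avatar of `Pf 1`.  Then `ρ` is an a.e. avatar of some `Pf τ`: `Ind ρ₁` and `Ind ρ`
are a.e. compatible with `P` (`eventually_satakeFrobCompatibleAt_induce_rank`, Satake uniqueness), their restrictions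
to `Γ_L` are the block-diagonals of the conjugates (`induce_restrictField_apply_coe`), semisimple with equal
Frobenius polynomials a.e., hence conjugate (Chebotarev + Brauer–Nesbitt), so `ρ ≅ ρ₁^a` for some `a ∈ Γ_K`
(H7), and `ρ₁^a` is the avatar of `Pf ā` (`eventually_outerConj_compatible_rank` + the family relation).
[cite: ArthurClozelAMS120, Ch. 3 Thm. 4.2 (b), (e) and Def. 6.1] [cite: SerreLinearRepresentations1977, §7.3 Prop. 22] -/
theorem pick_of_regular : ∀ (K L : Type) [Field K] [NumberField K] [Field L] [NumberField L] [Algebra K L] [IsGalois K L], (Module.finrank K L).Prime → ∀ (n : ℕ) (ℓ : ℕ) [Fact ℓ.Prime] (ι : PadicAlgCl ℓ ≃+* ℂ) (ρ : Literature.NumberTheory.GaloisRepresentations.FramedGaloisRep L (PadicAlgCl ℓ) n), ρ.toGaloisRep.IsIrreducible → (∀ g : Field.absoluteGaloisGroup K, g ∉ Set.range (Literature.NumberTheory.GaloisRepresentations.absGaloisRestrict K L) → ∀ P : GL (Fin n) (PadicAlgCl ℓ), Literature.NumberTheory.GaloisRepresentations.FramedRep.conj P (ρ.outerConj g) ≠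 ρ) → (∀ᶠ w : IsDedekindDomain.HeightOneSpectrum (NumberField.RingOfIntegers L) in Filter.cofinite, ρ.IsUnramifiedAt w) → ∀ (hK : Literature.NumberTheory.Automorphic.isCompact_glFiniteIntegralLevel (Module.finrank K L * n) K) (hL : Literature.NumberTheory.Automorphic.isCompact_glFiniteIntegralLevel n L) (P : Literature.NumberTheory.Automorphic.AutomorphicRepData (Literature.NumberTheory.Automorphic.AutomorphyDatum.gl (Module.finrank K L * n) K hK)), (∀ᶠ v : IsDedekindDomain.HeightOneSpectrum (NumberField.RingOfIntegers K) in Filter.cofinite, SatakeFrobCompatibleAt ι P (ρ.induce K (rfl : Module.finrank K L = Module.finrank K L)) v) → ∀ (Pf : (L ≃ₐ[K] L) → Literature.NumberTheory.Automorphic.CuspidalAutomorphicRepData n L hL), (∀ τ : L ≃ₐ[K] L, ∀ᶠ w : IsDedekindDomain.HeightOneSpectrum (NumberField.RingOfIntegers L) in Filter.cofinite, ∀ β : Multiset ℂ, (Pf 1).1.HasSatakeParamAt (τ • w) β → (Pf τ).1.HasSatakeParamAt w β) → (∀ τ : L ≃ₐ[K] L, Literature.NumberTheory.Automorphic.IsAutomorphicInductionAlong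 (Pf τ).1 P) → ∀ (ρ₁ : Literature.NumberTheory.GaloisRepresentations.FramedGaloisRep L (PadicAlgCl ℓ) n), ρ₁.toGaloisRep.IsIrreducible → (∀ᶠ w : IsDedekindDomain.HeightOneSpectrum (NumberField.RingOfIntegers L) in Filter.cofinite, SatakeFrobCompatibleAt ι (Pf 1).1 ρ₁ w) → ∃ τ : L ≃ₐ[K] L, ∀ᶠ w : IsDedekindDomain.HeightOneSpectrum (NumberField.RingOfIntegers L) in Filter.cofinite, SatakeFrobCompatibleAt ι (Pf τ).1 ρ w := by
  sorry

/-! ### The compositions (sorry-free modulo the helper stubs above) -/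

/-- **Case "ρ extends": weak (B) over `L` for `ρ = ρ₀|_{Γ_L}`** — `ρ₀` is irreducible and `R₀`-geometric (H2),
(B) over `K` gives its cuspidal L-algebraic avatar `π₀`, which is not self-twist at some inert place (H3), so
`BC_{L/K}(π₀)` is CUSPIDAL (`baseChange_cyclic_cuspidal`), L-algebraic (`isLAlgebraic_baseChange`) and a.e.
compatible with `ρ₀|_{Γ_L}` (`eventually_satakeFrobCompatibleAt_restrictField`). Facts, in this order:
`baseChange_cyclic_cuspidal`, `ArthurClozel1989_strongLifting_archimedean`, the de Rham descent schema (explicit).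
[cite: ArthurClozelAMS120, Ch. 3 Thm. 4.2 (a) and Thm. 5.1] [cite: BrinonConrad2009, Prop. 6.3.8] -/
theorem ascentWeakGalToAut_of_extends
    (hBCc : Literature.NumberTheory.Automorphic.baseChange_cyclic_cuspidal)
    (harch : Literature.NumberTheory.Automorphic.ArthurClozel1989_strongLifting_archimedean)
    (hDesc : ∀ (K L : Type) [Field K] [NumberField K] [Field L] [NumberField L] [Algebra K L] (ℓ : ℕ) [Fact ℓ.Prime] (n : ℕ) (ρ : Literature.NumberTheory.GaloisRepresentations.FramedGaloisRep K (PadicAlgCl ℓ) n), (∀ (w : IsDedekindDomain.HeightOneSpectrum (NumberField.RingOfIntegers L)) (hw : ((ℓ : ℕ) : NumberField.RingOfIntegers L) ∈ w.asIdeal), (Literature.NumberTheory.PAdicHodge.fontainePstAdicCompletion w ℓ hw).IsDeRhamFramed ((ρ.restrictField L).toLocal w)) → ∀ (v : IsDedekindDomain.HeightOneSpectrum (NumberField.RingOfIntegers K)) (hv : ((ℓ : ℕ) : NumberField.RingOfIntegers K) ∈ v.asIdeal), (Literature.NumberTheory.PAdicHodge.fontainePstAdicCompletion v ℓ hv).IsDeRhamFramed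 (ρ.toLocal v))
    (K L : Type) [Field K] [NumberField K] [Field L] [NumberField L] [Algebra K L] [IsGalois K L]
    (R : ReciprocityData L) (hp : (Module.finrank K L).Prime) (R₀ : ReciprocityData K)
    (hK : ∀ n : ℕ, 0 < n → ∀ hcpt : isCompact_glFiniteIntegralLevel n K, GlobalLanglandsCorrespondenceGLn n K R₀ hcpt)
    {n : ℕ} (hn : 0 < n) {ℓ : ℕ} [Fact ℓ.Prime] (ι : PadicAlgCl ℓ ≃+* ℂ)
    (ρ₀ : FramedGaloisRep K (PadicAlgCl ℓ) n) (hirr : (ρ₀.restrictField L).toGaloisRep.IsIrreducible)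
    (hgeo : IsGeometricFramed R (ρ₀.restrictField L)) (hcpt : isCompact_glFiniteIntegralLevel n L) :
    ∃ π : CuspidalAutomorphicRepData n L hcpt, π.1.IsLAlgebraic ∧
      ∀ᶠ w : HeightOneSpectrum (𝓞 L) in cofinite, SatakeFrobCompatibleAt ι π.1 (ρ₀.restrictField L) w := by
  haveI : FiniteDimensional K L := Module.Finite.of_restrictScalars_finite ℚ K L
  have hcyc : IsCyclic (L ≃ₐ[K] L) :=
    Theorems.BaseFieldAscentAscentConjugationSolvable.isCyclic_algEquiv_of_finrank_prime K L hp
  -- `ρ₀` is irreducible and `R₀`-geometric over `K`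
  have hirr₀ : ρ₀.toGaloisRep.IsIrreducible :=
    Theorems.IrreducibleOffSector.isIrreducible_of_isIrreducible_restrictField (L := L) ρ₀ hirr
  have hgeo₀ : IsGeometricFramed R₀ ρ₀ :=
    isGeometricFramed_of_restrictField_of_deRhamDescent hDesc K L R₀ R ℓ n ρ₀ hgeo
  -- (B) over `K` in rank `n`
  have hcptK : isCompact_glFiniteIntegralLevel n K := isCompact_glFiniteIntegralLevel_holds n K
  obtain ⟨-, hBK⟩ := hK n hn hcptK
  obtain ⟨π₀, hπ₀L, hcorr₀⟩ := hBK ℓ ι ρ₀ hirr₀ hgeo₀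
  -- a non-self-twist inert place, then CUSPIDAL cyclic base change
  have hne := exists_inert_nonSelfTwist_of_irreducible_restrictField K L hp n hcptK ℓ ι π₀.1 ρ₀ hirr hcorr₀.1
  obtain ⟨BC, hBC⟩ := hBCc n K L hp hcptK π₀ hne hcpt
  exact ⟨BC, harch.isLAlgebraic_baseChange hcyc hp hBC hπ₀L,
    Theorems.IrreducibleOffSector.eventually_satakeFrobCompatibleAt_restrictField ι π₀.1 BC.1 hBC ρ₀ hcorr₀.1⟩

/-- **Case "ρ Galois-regular": weak (B) over `L`** — `Ind_L^K ρ` is irreducible (H4) and `R₀`-geometric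
(`eventually_isUnramifiedAt_induce`, `IsDeRhamFramedInduceSchema`), (B) over `K` gives a cuspidal L-algebraic `P` on
`GL_{pn}(𝔸_K)` a.e. compatible with it, whose Satake data are `μ_p`-stable at the inert places (H6), so Arthur–Clozel
Thm. 4.2 (b) (`ArthurClozel1989_automorphicInduction_of_selfTwist`) gives the Galois-conjugate family `Pf τ` of
cuspidals on `GL_n(𝔸_L)` inducing to `P`; they are L-algebraic (H5), (A) over `L` gives the avatar `ρ₁` of `Pf 1`,
and the pick (H8) finds `τ` with `Pf τ` an a.e. avatar of `ρ`. Facts, in this order: the AI-of-self-twist fact,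
Henniart's infinity-type fact, existence of infinity types, `IsDeRhamFramedInduceSchema`.
[cite: ArthurClozelAMS120, Ch. 3 Thm. 4.2 (b), (e), Thm. 6.2] [cite: Henniart2012, Thm. 5] [cite: Patrikis2019, Lemma 7.2.1] -/
theorem ascentWeakGalToAut_of_regular
    (hAIsT : Literature.NumberTheory.Automorphic.ArthurClozel1989_automorphicInduction_of_selfTwist)
    (hHen : Literature.NumberTheory.Automorphic.Henniart2012_infinityType_of_automorphicInduction)
    (hinf : ∀ (n : ℕ) (K : Type) [Field K] [NumberField K] (hK : Literature.NumberTheory.Automorphic.isCompact_glFiniteIntegralLevel n K) (π : Literature.NumberTheory.Automorphic.AutomorphicRepData (Literature.NumberTheory.Automorphic.AutomorphyDatum.gl n K hK)), π.exists_hasInfinityType)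
    (hInd : Literature.NumberTheory.PAdicHodge.IsDeRhamFramedInduceSchema)
    (K L : Type) [Field K] [NumberField K] [Field L] [NumberField L] [Algebra K L] [IsGalois K L]
    (R : ReciprocityData L) (hp : (Module.finrank K L).Prime) (R₀ : ReciprocityData K)
    (hK : ∀ n : ℕ, 0 < n → ∀ hcpt : isCompact_glFiniteIntegralLevel n K, GlobalLanglandsCorrespondenceGLn n K R₀ hcpt)
    (hAL : ∀ n : ℕ, 0 < n → ∀ hcpt : isCompact_glFiniteIntegralLevel n L, AutomorphicToGalois n R hcpt)
    {n : ℕ} (hn : 0 < n) {ℓ : ℕ} [Fact ℓ.Prime] (ι : PadicAlgCl ℓ ≃+* ℂ)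
    (ρ : FramedGaloisRep L (PadicAlgCl ℓ) n) (hirr : ρ.toGaloisRep.IsIrreducible) (hgeo : IsGeometricFramed R ρ)
    (hreg : ∀ g : Field.absoluteGaloisGroup K, g ∉ Set.range (absGaloisRestrict K L) →
      ∀ P : GL (Fin n) (PadicAlgCl ℓ), FramedRep.conj P (ρ.outerConj g) ≠ ρ)
    (hcpt : isCompact_glFiniteIntegralLevel n L) :
    ∃ π : CuspidalAutomorphicRepData n L hcpt, π.1.IsLAlgebraic ∧
      ∀ᶠ w : HeightOneSpectrum (𝓞 L) in cofinite, SatakeFrobCompatibleAt ι π.1 ρ w := by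
  haveI : FiniteDimensional K L := Module.Finite.of_restrictScalars_finite ℚ K L
  have hcyc : IsCyclic (L ≃ₐ[K] L) :=
    Theorems.BaseFieldAscentAscentConjugationSolvable.isCyclic_algEquiv_of_finrank_prime K L hp
  have hd : 0 < Module.finrank K L := Module.finrank_pos
  -- `Ind ρ` is irreducible and `R₀`-geometric over `K`
  have hIrr : (ρ.induce K (rfl : Module.finrank K L = Module.finrank K L)).toGaloisRep.IsIrreducible :=
    isIrreducible_induce_of_regular K L ℓ n ρ hirr hreg
  have hgeoK : IsGeometricFramed R₀ (ρ.induce K (rfl : Module.finrank K L = Module.finrank K L)) :=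
    ⟨FramedGaloisRep.eventually_isUnramifiedAt_induce K rfl ρ hgeo.1,
      fun v hv => hInd K L (Module.finrank K L) rfl ℓ n ρ (fun w hw => hgeo.2 w hw) v hv⟩
  -- (B) over `K` in rank `p·n`
  have hcptK : isCompact_glFiniteIntegralLevel (Module.finrank K L * n) K :=
    isCompact_glFiniteIntegralLevel_holds _ K
  obtain ⟨-, hBK⟩ := hK (Module.finrank K L * n) (Nat.mul_pos hd hn) hcptK
  obtain ⟨P, hPL, hcorr⟩ := hBK ℓ ι _ hIrr hgeoK
  -- the Satake data of `P` are `μ_p`-stable at the inert places; Arthur–Clozel 4.2 (b): the family `Pf`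
  have hst := selfTwistStable_of_compatible_induce K L hp n ℓ ι ρ hgeo.1 hcptK P.1 hcorr.1
  obtain ⟨Pf, hfam, hAI⟩ := hAIsT K L (Module.finrank K L * n) n hp hn (Nat.mul_comm _ _) hcptK hcpt P hst
  -- every `Pf τ` is L-algebraic
  have hPfL : ∀ τ : L ≃ₐ[K] L, (Pf τ).1.IsLAlgebraic := fun τ =>
    isLAlgebraic_of_isAutomorphicInductionAlong hHen hinf K L hcyc n (Module.finrank K L) hn rfl hcptK hcpt P
      (Pf τ) (hAI τ) hPL
  -- (A) over `L` on `Pf 1`, then the pick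
  obtain ⟨ρ₁, hρ₁irr, -, hρ₁corr, -⟩ := hAL n hn hcpt (Pf 1) (hPfL 1) ℓ ι
  obtain ⟨τ, hτ⟩ := pick_of_regular K L hp n ℓ ι ρ hirr hreg hgeo.1 hcptK hcpt P.1 hcorr.1 Pf hfam hAI ρ₁ hρ₁irr
    hρ₁corr.1
  exact ⟨Pf τ, hPfL τ, hτ⟩

/-- **`stub_ascentWeakGalToAut` (18649 stub 2) modulo named facts**: the registered signature VERBATIM after seven
hypotheses — `baseChange_cyclic_cuspidal`, `ArthurClozel1989_strongLifting_archimedean`, the de Rham descent schema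
(explicit), `ArthurClozel1989_automorphicInduction_of_selfTwist`, `Henniart2012_infinityType_of_automorphicInduction`,
existence of infinity types, `IsDeRhamFramedInduceSchema` — by the extend-or-regular dichotomy (H1).
[cite: ArthurClozelAMS120, Ch. 3 Thms. 4.2 and 6.2] [cite: Clifford1937, Thm. 1] -/
theorem ascentWeakGalToAut_of_facts : Literature.NumberTheory.Automorphic.baseChange_cyclic_cuspidal → Literature.NumberTheory.Automorphic.ArthurClozel1989_strongLifting_archimedean → (∀ (K L : Type) [Field K] [NumberField K] [Field L] [NumberField L] [Algebra K L] (ℓ : ℕ) [Fact ℓ.Prime] (n : ℕ) (ρ : Literature.NumberTheory.GaloisRepresentations.FramedGaloisRep K (PadicAlgCl ℓ) n), (∀ (w : IsDedekindDomain.HeightOneSpectrum (NumberField.RingOfIntegers L)) (hw : ((ℓ : ℕ) : NumberField.RingOfIntegers L) ∈ w.asIdeal), (Literature.NumberTheory.PAdicHodge.fontainePstAdicCompletion w ℓ hw).IsDeRhamFramed ((ρ.restrictField L).toLocal w)) → ∀ (v : IsDedekindDomain.HeightOneSpectrum (NumberField.RingOfIntegers K)) (hv : ((ℓ : ℕ)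 : NumberField.RingOfIntegers K) ∈ v.asIdeal), (Literature.NumberTheory.PAdicHodge.fontainePstAdicCompletion v ℓ hv).IsDeRhamFramed (ρ.toLocal v)) → Literature.NumberTheory.Automorphic.ArthurClozel1989_automorphicInduction_of_selfTwist → Literature.NumberTheory.Automorphic.Henniart2012_infinityType_of_automorphicInduction → (∀ (n : ℕ) (K : Type) [Field K] [NumberField K] (hK : Literature.NumberTheory.Automorphic.isCompact_glFiniteIntegralLevel n K) (π : Literature.NumberTheory.Automorphic.AutomorphicRepData (Literature.NumberTheory.Automorphic.AutomorphyDatum.gl n K hK)), π.exists_hasInfinityType) → Literature.NumberTheory.PAdicHodge.IsDeRhamFramedInduceSchema → ∀ (K L : Type) [Field K] [NumberField K] [Field L] [NumberField L] [Algebra K L] [IsGalois K L] (R : ReciprocityData L), (Module.finrank K L).Prime → (∃ R₀ : ReciprocityData K, ∀ n : ℕ, 0 < n → ∀ hcpt : Literature.NumberTheory.Automorphic.isCompact_glFiniteIntegralLevel n K, GlobalLanglandsCorrespondenceGLn n K R₀ hcpt) → (∀ n : ℕ, 0 < n → ∀ hcpt : Literature.NumberTheory.Automorphic.isCompact_glFiniteIntegralLevel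 n L, AutomorphicToGalois n R hcpt) → ∀ (n : ℕ), 0 < n → ∀ (ℓ : ℕ) [Fact ℓ.Prime] (ι : PadicAlgCl ℓ ≃+* ℂ) (ρ : Literature.NumberTheory.GaloisRepresentations.FramedGaloisRep L (PadicAlgCl ℓ) n), ρ.toGaloisRep.IsIrreducible → IsGeometricFramed R ρ → ∀ hcpt : Literature.NumberTheory.Automorphic.isCompact_glFiniteIntegralLevel n L, ∃ π : Literature.NumberTheory.Automorphic.CuspidalAutomorphicRepData n L hcpt, π.1.IsLAlgebraic ∧ ∀ᶠ v : IsDedekindDomain.HeightOneSpectrum (NumberField.RingOfIntegers L) in cofinite, SatakeFrobCompatibleAt ι π.1 ρ v := by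
  intro hBCc harch hDesc hAIsT hHen hinf hInd K L _ _ _ _ _ _ R hp hRK hAL n hn ℓ _ ι ρ hirr hgeo hcpt
  obtain ⟨R₀, hK⟩ := hRK
  rcases extendsOrRegular_of_prime K L hp ℓ n ρ hirr with ⟨ρ₀, rfl⟩ | hreg
  · exact ascentWeakGalToAut_of_extends hBCc harch hDesc K L R hp R₀ hK hn ι ρ₀ hirr hgeo hcpt
  · exact ascentWeakGalToAut_of_regular hAIsT hHen hinf hInd K L R hp R₀ hK hAL hn ι ρ hirr hgeo hreg hcpt

/-- **The crux from the two (A)-halves, modulo named facts** (lead c3): `AscentConjugationSolvable` (shared decl,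
`SmithKummerSeed` spelling) ⇐ `stub_ascentAutToGal` (18649 stub 1) ∧ `stub_descentAutToGal` (18645 stub 1), granted
— in this order — `cuspidal_descent_cyclic`, `ArthurClozel1989_strongLifting_archimedean`, existence of infinity
types, `automorphicInduction_cyclic_cuspidal`, `Henniart2012_infinityType_of_automorphicInduction`,
`baseChange_cyclic_cuspidal`, the de Rham descent schema (explicit), `ArthurClozel1989_automorphicInduction_of_selfTwist`,
`IsDeRhamFramedInduceSchema` (`DeRhamBaseChange` being DISCHARGED, `DeRhamBaseChange_holds`): both (B)-halves are
theorems (`descentWeakGalToAut_of_facts`, p168792; `ascentWeakGalToAut_of_facts`, above).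
[cite: ArthurClozelAMS120, Ch. 3 Thms. 4.2, 5.1, 6.2] [cite: Henniart2012, Thm. 5] [cite: BrinonConrad2009, Prop. 6.3.8] -/
theorem ascentConjugationSolvable_of_twoStubs_of_facts : Literature.NumberTheory.Automorphic.cuspidal_descent_cyclic → Literature.NumberTheory.Automorphic.ArthurClozel1989_strongLifting_archimedean → (∀ (n : ℕ) (K : Type) [Field K] [NumberField K] (hK : Literature.NumberTheory.Automorphic.isCompact_glFiniteIntegralLevel n K) (π : Literature.NumberTheory.Automorphic.AutomorphicRepData (Literature.NumberTheory.Automorphic.AutomorphyDatum.gl n K hK)), π.exists_hasInfinityType) → Literature.NumberTheory.Automorphic.automorphicInduction_cyclic_cuspidal → Literature.NumberTheory.Automorphic.Henniart2012_infinityType_of_automorphicInduction → Literature.NumberTheory.Automorphic.baseChange_cyclic_cuspidal → (∀ (K L : Type) [Field K] [NumberField K] [Field L] [NumberField L] [Algebra K L] (ℓ : ℕ) [Fact ℓ.Prime] (n : ℕ) (ρ : Literature.NumberTheory.GaloisRepresentations.FramedGaloisRep K (PadicAlgCl ℓ) n), (∀ (w : IsDedekindDomain.HeightOneSpectrum (NumberField.RingOfIntegers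 L)) (hw : ((ℓ : ℕ) : NumberField.RingOfIntegers L) ∈ w.asIdeal), (Literature.NumberTheory.PAdicHodge.fontainePstAdicCompletion w ℓ hw).IsDeRhamFramed ((ρ.restrictField L).toLocal w)) → ∀ (v : IsDedekindDomain.HeightOneSpectrum (NumberField.RingOfIntegers K)) (hv : ((ℓ : ℕ) : NumberField.RingOfIntegers K) ∈ v.asIdeal), (Literature.NumberTheory.PAdicHodge.fontainePstAdicCompletion v ℓ hv).IsDeRhamFramed (ρ.toLocal v)) → Literature.NumberTheory.Automorphic.ArthurClozel1989_automorphicInduction_of_selfTwist → Literature.NumberTheory.PAdicHodge.IsDeRhamFramedInduceSchema → (∀ (K L : Type) [Field K] [NumberField K] [Field L] [NumberField L] [Algebra K L] [IsGalois K L], (Module.finrank K L).Prime → (∃ R : ReciprocityData K, ∀ n : ℕ, 0 < n → ∀ hcpt : Literature.NumberTheory.Automorphic.isCompact_glFiniteIntegralLevel n K, GlobalLanglandsCorrespondenceGLn n K R hcpt) → ∃ R : ReciprocityData L, ∀ n : ℕ, 0 < n → ∀ hcpt : Literature.NumberTheory.Automorphic.isCompact_glFiniteIntegralLevel n L, AutomorphicToGalois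 n R hcpt) → (∀ (K L : Type) [Field K] [NumberField K] [Field L] [NumberField L] [Algebra K L] [IsGalois K L], (Module.finrank K L).Prime → (∃ R : ReciprocityData L, ∀ n : ℕ, 0 < n → ∀ hcpt : Literature.NumberTheory.Automorphic.isCompact_glFiniteIntegralLevel n L, GlobalLanglandsCorrespondenceGLn n L R hcpt) → ∃ R : ReciprocityData K, ∀ n : ℕ, 0 < n → ∀ hcpt : Literature.NumberTheory.Automorphic.isCompact_glFiniteIntegralLevel n K, AutomorphicToGalois n R hcpt) → Summit.Langlands.Langlands.Theses.SmithKummerSeed.AscentConjugationSolvable :=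
  fun hdesc harch hinf hAIf hHen hBCc hDesc hAIsT hInd hA₁ hD₁ =>
    Theorems.SmithKummerSeedCyclicPrimeDescent.ascentConjugationSolvable_of_threeStubs_of_facts hdesc harch hinf
      DeRhamBaseChange_holds hAIf hHen hA₁ (ascentWeakGalToAut_of_facts hBCc harch hDesc hAIsT hHen hinf hInd) hD₁

end LeadC3

end Summit.Langlands.Langlands.Cruxes.AscentConjugationSolvable.Birth

end
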